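import Summits.ValiantsHypothesis.ValiantsHypothesis.Theorems.KPlusLogSqLawStaticPathChainFloor
import Summits.ValiantsHypothesis.ValiantsHypothesis.Theorems.KPlusLogSqLawStaticPathCertFifteenPart3

/-!
# Route «KPlusLogSqLaw» — parametric max-weight independent set on a path: the all-`n` floor of rate `26/16` from the `n = 15` certificate

HONEST FRAMING.  Helper toward the crux `WeakLifting` (item `stmt-ValiantsHypothesis-19561`, route `KPlusLogSqLaw`, cell `pub-symmetroid`,
seat val-sym-lift-p4 g8, 2026-08-27) on the line of its witness-plan stub `stub_tridiagonalSectorB` (tropical twin of the STATIC tridiagonal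
sector = parametric maximum-weight independent set on a path).  `exists_chain_floor` (blocks + padding over the gluing theorem) applied
to the kernel certificate `exists_chain_twentysix_on_fifteen` of the located `n = 15` maximiser (LINEAR-LAW, `bp(15) = 26 = 2n - 4`):
every block of `m` items carries weights affine in `θ` with a chain of `26 · ⌊(m+1)/16⌋ ≥ 1.625 m - 26` changes of the unique optimum —
the best kernel floor of the static path sector to date (rate `1` from `exists_chain_length`, `4/3` from `exists_chain_floor_eight`);
the located law is `2n - 4`, the kernel ceiling is `chain_le` / `chain_le_card_eventCrossings`.  Nothing here asserts anything about
`WeakLifting`, `TropicalB`, `KPlusLogSqLaw`, the stub in its window, `MatrixDescartes` (stmt-ValiantsHypothesis-18050) or `VP ≠ VNP`.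
-/

set_option linter.dupNamespace false
set_option autoImplicit false

namespace Summit.ValiantsHypothesis.ValiantsHypothesis.Theorems.KPlusLogSqLaw

open Finset Classical

namespace StaticPathFold

noncomputable section

/-- **rate `26/16` for all `n`** (from the kernel certificate `exists_chain_twentysix_on_fifteen`): every block of `m` items carries
weights affine in `θ` with a chain of `26 · ⌊(m+1)/16⌋` changes of the unique optimum. [folklore] -/
theorem exists_chain_floor_fifteen (m : ℕ) :
    ∃ (w₁ w₀ : ℕ → ℝ) (θs : Fin (26 * ((m + 1) / 16) + 1) → ℝ) (Ms : Fin (26 * ((m + 1) / 16) + 1) → Finset ℕ),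
      StrictMono θs ∧ (∀ j, Ms j ∈ indepSets 0 m) ∧
      (∀ j, ∀ S ∈ indepSets 0 m, S ≠ Ms j → ∑ t ∈ S, W w₁ w₀ t (θs j) < ∑ t ∈ Ms j, W w₁ w₀ t (θs j)) ∧
      (∀ e : Fin (26 * ((m + 1) / 16)), Ms e.castSucc ≠ Ms e.succ) :=
  exists_chain_floor exists_chain_twentysix_on_fifteen m

/-- the same floor in the currency of a lower bound: for `m ≥ 15` items at least `26 ⌊(m+1)/16⌋ ≥ (13 m - 182) / 8` changes, i.e. rate
`1.625`. (Arithmetic form of the index count, for citation.) [folklore] -/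
theorem floor_fifteen_rate (m : ℕ) : 13 * m ≤ 8 * (26 * ((m + 1) / 16)) + 182 := by
  omega

end

end StaticPathFold

end Summit.ValiantsHypothesis.ValiantsHypothesis.Theorems.KPlusLogSqLaw
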